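import Mathlib
import HarnessLib

/-!
# Crux K2 `PoloidalWindowRigidity` (stmt-NavierStokesRegularity-19708), line `z_shock` — the TWO-SIDED RICCATI LEMMA
# (ODE kernel of rung R2 «Lax 1964 / John 1974 read two-sidedly» behind the deciding stub `stub_zShockThickAut`)

`--supports stmt-NavierStokesRegularity-19708 --as helper` (leafhand-ns-poloidalwindowdoor-1 g0, 2026-08-30).  Class-free real
analysis, Mathlib only.  **No stub and no summit is closed by this file; Navier–Stokes regularity is NOT proved here.**

The line card `Cruxes/PoloidalWindowRigidity/Lines/z_shock.md` (§Idea, §First rung, rung R2, §Hardest stub) rests the deciding stub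
`stub_zShockThickAut` (thick = genuinely nonlinear, z-autonomous height-evolution `w_zz + Δₕ[g(t,w)] = 0`, two-sided eternal bounded
slices) on ONE mechanism: along a characteristic the gradient `q` of a Riemann invariant obeys the exact Riccati law
`q' = −a e^{−h} q²` with `a ≠ 0` of one sign and `h` bounded (John's integrating factor), so a datum `q ≠ 0` blows up FORWARD or
BACKWARD in the height `z` in finite height `≍ 1/(|a| e^{-H} |q|)`; a two-sided eternal `C¹` solution therefore has `q ≡ 0`
(Lax 1964; John 1974; Hörmander 1997 §4.2; the card's instrument I2 measures exactly the height `z* ≈ 4/(εA)`).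

This file proves that kernel as stand-alone lemmas about a real function `q` with `q'(z) = −b(z)·q(z)²`:
* `inv_sub_inv_ge` — on an interval where `q > 0`, `1/q` grows at least like `C·(height)` if `b ≥ C`;
* `le_of_riccati_backward` — BACKWARD MONOTONICITY: if `b ≥ 0` on `[z₁, z₀]` and `q(z₀) > 0` then `q ≥ q(z₀) > 0` on `[z₁, z₀]`
  (no zero can be crossed backward: the last zero would be approached from the right by values `≥ q(z₀)`);
* `riccati_backward_lifespan` — QUANTITATIVE LIFESPAN: if moreover `b ≥ b₀ > 0` on `[z₁, z₀]` then `z₀ − z₁ < 1/(b₀ q(z₀))`;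
* `riccati_twoSided_eq_zero` — TWO-SIDED LIOUVILLE: a solution on all of `ℝ` with `b ≥ b₀ > 0` vanishes identically
  (positive data die backward, negative data die forward — by the reflection `z ↦ −z`, `q ↦ −q`);
* `riccati_twoSided_eq_zero_of_le_neg` (`b ≤ −b₀ < 0`) and `riccati_twoSided_eq_zero_exp` (John's form `b = a e^{−h}`, `|h| ≤ H`).
* (appended) `dampedRiccati_twoSided_eq_zero{,_of_le_neg}` — the DAMPED law `α' = −aα² − h'α` (Lax's (2.6) before John's substitution
  `q = e^{h}α`): `a` of one sign bounded away from `0`, `h` bounded ⇒ `α ≡ 0`.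
* (appended) `dampedRiccati_backward_lifespan` — quantitative: on `[z₁, z₀]`, `α(z₀) > 0` forces `z₀ − z₁ < e^{2H}/(a₀ α(z₀))`.

presearch: «two-sided Riccati blow-up along characteristics, genuinely nonlinear, eternal ⇒ constant» → [corpus:book:alinhac2009
pp.44–46] (genuinely nonlinear / linearly degenerate modes; not the lemma) · tree: `lean search Riccati` — only special Riccati flows
(`ChenHou2024…riccatiFlow`, `ODE/RiccatiCrumShift`), no two-sided Liouville lemma.  References: P. D. Lax, J. Math. Phys. 5 (1964)
611–613; F. John, Comm. Pure Appl. Math. 27 (1974) 377–405; L. Hörmander, *Lectures on Nonlinear Hyperbolic Differential Equations*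
(1997) §4.2. [folklore]
-/

noncomputable section

namespace Summit.NavierStokesRegularity.NavierStokesRegularity.Theorems.PoloidalWindowDoorPoloidalWindowRigidityZShockRiccatiTwoSided

-- the problem directory repeats the summit name (`NavierStokesRegularity/NavierStokesRegularity`)
set_option linter.dupNamespace false

open Set Filter Topology

/-- **Growth of `1/q` on a positivity interval.** If `q' = −b q²` at every point of `[x, y]`, `q > 0` on `[x, y]` and `b ≥ C`
on `[x, y]`, then `C·(y − x) ≤ 1/q(y) − 1/q(x)` (mean value inequality for `1/q`, whose derivative is `b`). [folklore] -/
theorem inv_sub_inv_ge {q b : ℝ → ℝ} {C x y : ℝ} (hxy : x ≤ y)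
    (hq : ∀ z ∈ Icc x y, HasDerivAt q (-(b z * q z ^ 2)) z)
    (hpos : ∀ z ∈ Icc x y, 0 < q z) (hC : ∀ z ∈ Icc x y, C ≤ b z) :
    C * (y - x) ≤ (q y)⁻¹ - (q x)⁻¹ := by
  -- `1/q` has derivative `b` at every point of `[x, y]`
  have hinv : ∀ z ∈ Icc x y, HasDerivAt (fun w => (q w)⁻¹) (b z) z := by
    intro z hz
    have hne : q z ≠ 0 := (hpos z hz).ne'
    have h := (hq z hz).inv hne
    have e : -(-(b z * q z ^ 2)) / q z ^ 2 = b z := by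
      rw [neg_neg, mul_div_assoc, div_self (pow_ne_zero 2 hne), mul_one]
    rw [e] at h
    exact h
  have hcont : ContinuousOn (fun w => (q w)⁻¹) (Icc x y) :=
    fun z hz => (hinv z hz).continuousAt.continuousWithinAt
  have hdiff : DifferentiableOn ℝ (fun w => (q w)⁻¹) (interior (Icc x y)) := by
    intro z hz
    rw [interior_Icc] at hz
    exact (hinv z (Ioo_subset_Icc_self hz)).differentiableAt.differentiableWithinAt
  have hge : ∀ z ∈ interior (Icc x y), C ≤ deriv (fun w => (q w)⁻¹) z := by
    intro z hz
    rw [interior_Icc] at hz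
    rw [(hinv z (Ioo_subset_Icc_self hz)).deriv]
    exact hC z (Ioo_subset_Icc_self hz)
  exact (convex_Icc x y).mul_sub_le_image_sub_of_le_deriv hcont hdiff hge x (left_mem_Icc.2 hxy) y
    (right_mem_Icc.2 hxy) hxy

/-- **Backward monotonicity (no zero is crossed backward).** If `q' = −b q²` with `b ≥ 0` at every point of `[z₁, z₀]` and
`q(z₀) > 0`, then `q(z) ≥ q(z₀)` for every `z ∈ [z₁, z₀]`; in particular `q > 0` on `[z₁, z₀]`.  Proof: if `q ≤ 0` somewhere,
the last such point `z* < z₀` is a limit of points of `(z*, z₀]` where `q > 0` and `1/q` is non-decreasing, i.e. `q ≥ q(z₀)`,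
so `q(z*) ≥ q(z₀) > 0` by continuity — absurd. [folklore] -/
theorem le_of_riccati_backward {q b : ℝ → ℝ} {z₁ z₀ : ℝ}
    (hq : ∀ z ∈ Icc z₁ z₀, HasDerivAt q (-(b z * q z ^ 2)) z)
    (hb : ∀ z ∈ Icc z₁ z₀, 0 ≤ b z) (hpos : 0 < q z₀) :
    ∀ z ∈ Icc z₁ z₀, q z₀ ≤ q z := by
  have hqc : ContinuousOn q (Icc z₁ z₀) := fun z hz => (hq z hz).continuousAt.continuousWithinAt
  -- on a sub-interval `[z, z₀]` where `q > 0`, `q ≥ q z₀`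
  have key : ∀ z ∈ Icc z₁ z₀, (∀ w ∈ Icc z z₀, 0 < q w) → q z₀ ≤ q z := by
    intro z hz hposI
    have hsub : Icc z z₀ ⊆ Icc z₁ z₀ := Icc_subset_Icc_left hz.1
    have h := inv_sub_inv_ge (C := 0) hz.2 (fun w hw => hq w (hsub hw)) hposI (fun w hw => hb w (hsub hw))
    have h' : (q z)⁻¹ ≤ (q z₀)⁻¹ := by linarith
    exact (inv_le_inv₀ (hposI z (left_mem_Icc.2 hz.2)) hpos).1 h'
  -- the set of bad points is empty
  set S : Set ℝ := Icc z₁ z₀ ∩ q ⁻¹' Iic 0 with hS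
  by_cases hSe : S = ∅
  · intro z hz
    refine key z hz fun w hw => ?_
    by_contra hle
    have : w ∈ S := ⟨Icc_subset_Icc_left hz.1 hw, not_lt.1 hle⟩
    rw [hSe] at this
    exact this.elim
  · exfalso
    have hne : S.Nonempty := nonempty_iff_ne_empty.2 hSe
    have hbdd : BddAbove S := ⟨z₀, fun w hw => hw.1.2⟩
    have hScl : IsClosed S := hqc.preimage_isClosed_of_isClosed isClosed_Icc isClosed_Iic
    set zs := sSup S with hzs
    have hzsS : zs ∈ S := hScl.csSup_mem hne hbdd
    have hzs0 : q zs ≤ 0 := hzsS.2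
    have hzslt : zs < z₀ := by
      rcases eq_or_lt_of_le hzsS.1.2 with h | h
      · exact absurd (h ▸ hzs0) (not_le.2 hpos)
      · exact h
    -- on `(zs, z₀]`, `q > 0` and hence `q ≥ q z₀`
    have hposI : ∀ w ∈ Ioc zs z₀, 0 < q w := by
      intro w hw
      by_contra hle
      have hwS : w ∈ S := ⟨⟨hzsS.1.1.trans hw.1.le, hw.2⟩, not_lt.1 hle⟩
      exact absurd (le_csSup hbdd hwS) (not_le.2 hw.1)
    have hgeI : ∀ w ∈ Ioc zs z₀, q z₀ ≤ q w := fun w hw =>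
      key w ⟨hzsS.1.1.trans hw.1.le, hw.2⟩ fun w' hw' => hposI w' ⟨hw.1.trans_le hw'.1, hw'.2⟩
    -- pass to the limit `w ↓ zs` inside the closed set `{w ∈ [z₁, z₀] | q z₀ ≤ q w}`
    have hTcl : IsClosed (Icc z₁ z₀ ∩ q ⁻¹' Ici (q z₀)) :=
      hqc.preimage_isClosed_of_isClosed isClosed_Icc isClosed_Ici
    have hsubT : Ioc zs z₀ ⊆ Icc z₁ z₀ ∩ q ⁻¹' Ici (q z₀) := fun w hw =>
      ⟨⟨hzsS.1.1.trans hw.1.le, hw.2⟩, hgeI w hw⟩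
    have hmem : zs ∈ closure (Ioc zs z₀) := by
      rw [closure_Ioc hzslt.ne]
      exact left_mem_Icc.2 hzslt.le
    have hzsT : zs ∈ Icc z₁ z₀ ∩ q ⁻¹' Ici (q z₀) :=
      closure_minimal hsubT hTcl hmem
    have : q z₀ ≤ q zs := hzsT.2
    linarith

/-- **Quantitative backward lifespan (Lax–John height).** If `q' = −b q²` with `b ≥ b₀ > 0` at every point of `[z₁, z₀]` and
`q(z₀) > 0`, then `z₀ − z₁ < 1/(b₀ q(z₀))`: a positive datum cannot be continued backward as a `C¹` solution past the height
`1/(b₀ q(z₀))` (`1/q(z₁) ≤ 1/q(z₀) − b₀ (z₀ − z₁)` must stay positive). [folklore] -/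
theorem riccati_backward_lifespan {q b : ℝ → ℝ} {z₁ z₀ b₀ : ℝ} (hz : z₁ ≤ z₀) (hb₀ : 0 < b₀)
    (hq : ∀ z ∈ Icc z₁ z₀, HasDerivAt q (-(b z * q z ^ 2)) z)
    (hb : ∀ z ∈ Icc z₁ z₀, b₀ ≤ b z) (hpos : 0 < q z₀) :
    z₀ - z₁ < (b₀ * q z₀)⁻¹ := by
  have hposI : ∀ z ∈ Icc z₁ z₀, 0 < q z := fun z hzI =>
    hpos.trans_le (le_of_riccati_backward hq (fun w hw => hb₀.le.trans (hb w hw)) hpos z hzI)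
  have h := inv_sub_inv_ge hz hq hposI hb
  have h1 : 0 < (q z₁)⁻¹ := inv_pos.2 (hposI z₁ (left_mem_Icc.2 hz))
  have h2 : b₀ * (z₀ - z₁) < (q z₀)⁻¹ := by linarith
  rw [mul_inv, lt_inv_mul_iff₀ hb₀]
  simpa [mul_comm] using h2

/-- **Two-sided Riccati Liouville lemma (Lax 1964 / John 1974 read two-sidedly).** If `q : ℝ → ℝ` satisfies
`q'(z) = −b(z) q(z)²` at EVERY `z ∈ ℝ` with `b ≥ b₀ > 0`, then `q ≡ 0`: a positive value at `z₀` cannot be continued backward past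
height `1/(b₀ q(z₀))` (`riccati_backward_lifespan`), and a negative value is a positive value of the reflected solution
`z ↦ −q(−z)` of the same law with coefficient `b(−z)`, which cannot be continued forward. [folklore] -/
theorem riccati_twoSided_eq_zero {q b : ℝ → ℝ} {b₀ : ℝ} (hb₀ : 0 < b₀) (hb : ∀ z, b₀ ≤ b z)
    (hq : ∀ z, HasDerivAt q (-(b z * q z ^ 2)) z) : ∀ z, q z = 0 := by
  -- no positive value anywhere
  have nopos : ∀ {q b : ℝ → ℝ}, (∀ z, b₀ ≤ b z) → (∀ z, HasDerivAt q (-(b z * q z ^ 2)) z) → ∀ z₀, q z₀ ≤ 0 := by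
    intro q b hb hq z₀
    by_contra hpos'
    have hpos : 0 < q z₀ := not_le.1 hpos'
    set z₁ : ℝ := z₀ - (b₀ * q z₀)⁻¹ with hz₁
    have hz : z₁ ≤ z₀ := by
      have : 0 ≤ (b₀ * q z₀)⁻¹ := inv_nonneg.2 (mul_pos hb₀ hpos).le
      rw [hz₁]; linarith
    have h := riccati_backward_lifespan hz hb₀ (fun z _ => hq z) (fun z _ => hb z) hpos
    rw [hz₁] at h
    linarith
  intro z₀
  have h1 : q z₀ ≤ 0 := nopos hb hq z₀
  -- the reflected solution `Q y = -q (-y)` solves the same law with coefficient `b (-y)`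
  have hQ : ∀ y, HasDerivAt (fun y => -q (-y)) (-(b (-y) * (-q (-y)) ^ 2)) y := by
    intro y
    have h := ((hq (-y)).comp y (hasDerivAt_neg y)).neg
    exact h.congr_deriv (by ring)
  have h2 : -q (-(-z₀)) ≤ 0 := nopos (fun y => hb (-y)) hQ (-z₀)
  rw [neg_neg] at h2
  linarith

/-- **Two-sided Riccati Liouville lemma, negative coefficient.** If `q'(z) = −b(z) q(z)²` on `ℝ` with `b ≤ −b₀ < 0`, then
`q ≡ 0` (apply `riccati_twoSided_eq_zero` to `−q`, which solves the law with coefficient `−b ≥ b₀`). [folklore] -/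
theorem riccati_twoSided_eq_zero_of_le_neg {q b : ℝ → ℝ} {b₀ : ℝ} (hb₀ : 0 < b₀) (hb : ∀ z, b z ≤ -b₀)
    (hq : ∀ z, HasDerivAt q (-(b z * q z ^ 2)) z) : ∀ z, q z = 0 := by
  have hQ : ∀ z, HasDerivAt (fun z => -q z) (-((-b z) * (-q z) ^ 2)) z := fun z =>
    (hq z).neg.congr_deriv (by ring)
  have h := riccati_twoSided_eq_zero (q := fun z => -q z) (b := fun z => -b z) hb₀ (fun z => by linarith [hb z]) hQ
  intro z
  have := h z
  simp only [neg_eq_zero] at this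
  exact this

/-- **John's form.** If `q'(z) = −a·e^{−h(z)}·q(z)²` on `ℝ` with a constant `a ≠ 0` and `|h| ≤ H`, then `q ≡ 0`: the coefficient
`a e^{−h}` has the sign of `a` and modulus `≥ |a| e^{−H} > 0`.  This is the exact shape of the gradient law of a Riemann invariant
along a characteristic of a genuinely nonlinear `2 × 2` system with John's integrating factor (rung R2 of line `z_shock`). [folklore] -/
theorem riccati_twoSided_eq_zero_exp {q h : ℝ → ℝ} {a H : ℝ} (ha : a ≠ 0) (hH : ∀ z, |h z| ≤ H)
    (hq : ∀ z, HasDerivAt q (-(a * Real.exp (-h z) * q z ^ 2)) z) : ∀ z, q z = 0 := by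
  have hexp : ∀ z, Real.exp (-H) ≤ Real.exp (-h z) := fun z =>
    Real.exp_le_exp.2 (by linarith [hH z, le_abs_self (h z)])
  have hpos : 0 < |a| * Real.exp (-H) := mul_pos (abs_pos.2 ha) (Real.exp_pos _)
  rcases lt_or_gt_of_ne ha with hneg | hposa
  · -- `a < 0`: coefficient `≤ -(|a| e^{-H})`
    refine riccati_twoSided_eq_zero_of_le_neg (b := fun z => a * Real.exp (-h z)) hpos (fun z => ?_) hq
    have : |a| = -a := abs_of_neg hneg
    rw [this]
    have := mul_le_mul_of_nonpos_left (hexp z) hneg.le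
    linarith
  · -- `a > 0`: coefficient `≥ |a| e^{-H}`
    refine riccati_twoSided_eq_zero (b := fun z => a * Real.exp (-h z)) hpos (fun z => ?_) hq
    have : |a| = a := abs_of_pos hposa
    rw [this]
    exact mul_le_mul_of_nonneg_left (hexp z) hposa.le

/-! ### Appended (leafhand g0, second proposal): John's integrating factor — the DAMPED Riccati law `α' = −a α² − h' α` -/

/-- **John's integrating factor (two-sided Liouville for the damped Riccati law).**  Along a characteristic of a genuinely
nonlinear `2 × 2` system the `x`-derivative `α` of a Riemann invariant obeys `α' = −a·α² − h'·α`, where `a` (= `∂λ/∂r`) has a fixed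
sign and is bounded away from `0`, and `h` is a BOUNDED function of the other invariant (Lax 1964, eq. (2.6); John 1974, §2).  If such a
law holds on all of `ℝ` with `a ≥ a₀ > 0` and `|h| ≤ H`, then `α ≡ 0`: the substitution `q := e^{h} α` gives `q' = −(a e^{−h}) q²` with
coefficient `≥ a₀ e^{−H} > 0`, and `riccati_twoSided_eq_zero` applies.  This is the exact ODE step between the reduction to
characteristics and the constancy of the Riemann invariants in rung R2 of line `z_shock`. [folklore] -/
theorem dampedRiccati_twoSided_eq_zero {α a h h' : ℝ → ℝ} {a₀ H : ℝ} (ha₀ : 0 < a₀) (ha : ∀ z, a₀ ≤ a z)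
    (hH : ∀ z, |h z| ≤ H) (hh : ∀ z, HasDerivAt h (h' z) z)
    (hα : ∀ z, HasDerivAt α (-(a z * α z ^ 2) - h' z * α z) z) : ∀ z, α z = 0 := by
  -- `q := e^{h} α` solves the undamped law with coefficient `a e^{-h}`
  set q : ℝ → ℝ := fun z => Real.exp (h z) * α z with hq
  have hqd : ∀ z, HasDerivAt q (-(a z * Real.exp (-h z) * q z ^ 2)) z := by
    intro z
    have he : HasDerivAt (fun y => Real.exp (h y)) (Real.exp (h z) * h' z) z := (hh z).exp
    have hprod := he.mul (hα z)
    refine hprod.congr_deriv ?_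
    have hexp : Real.exp (-h z) * Real.exp (h z) = 1 := by rw [← Real.exp_add]; simp
    simp only [hq]
    have : a z * Real.exp (-h z) * (Real.exp (h z) * α z) ^ 2 =
        a z * α z ^ 2 * Real.exp (h z) * (Real.exp (-h z) * Real.exp (h z)) := by ring
    rw [this, hexp]
    ring
  have hcoef : ∀ z, a₀ * Real.exp (-H) ≤ a z * Real.exp (-h z) := by
    intro z
    have h1 : Real.exp (-H) ≤ Real.exp (-h z) := Real.exp_le_exp.2 (by linarith [hH z, le_abs_self (h z)])
    have h2 : 0 ≤ a z := ha₀.le.trans (ha z)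
    calc a₀ * Real.exp (-H) ≤ a z * Real.exp (-H) :=
          mul_le_mul_of_nonneg_right (ha z) (Real.exp_pos _).le
      _ ≤ a z * Real.exp (-h z) := mul_le_mul_of_nonneg_left h1 h2
  have hq0 := riccati_twoSided_eq_zero (b := fun z => a z * Real.exp (-h z)) (mul_pos ha₀ (Real.exp_pos _)) hcoef hqd
  intro z
  have hz := hq0 z
  simp only [hq, mul_eq_zero, Real.exp_ne_zero, false_or] at hz
  exact hz

/-- **Damped Riccati law, negative coefficient** (`a ≤ −a₀ < 0`; apply the previous lemma to `−α`, whose law has coefficient `−a`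
and the same damping `h'`). [folklore] -/
theorem dampedRiccati_twoSided_eq_zero_of_le_neg {α a h h' : ℝ → ℝ} {a₀ H : ℝ} (ha₀ : 0 < a₀) (ha : ∀ z, a z ≤ -a₀)
    (hH : ∀ z, |h z| ≤ H) (hh : ∀ z, HasDerivAt h (h' z) z)
    (hα : ∀ z, HasDerivAt α (-(a z * α z ^ 2) - h' z * α z) z) : ∀ z, α z = 0 := by
  have hβ : ∀ z, HasDerivAt (fun z => -α z) (-((-a z) * (-α z) ^ 2) - h' z * (-α z)) z := fun z =>
    (hα z).neg.congr_deriv (by ring)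
  have h := dampedRiccati_twoSided_eq_zero (α := fun z => -α z) (a := fun z => -a z) ha₀
    (fun z => by linarith [ha z]) hH hh hβ
  intro z
  have := h z
  simp only [neg_eq_zero] at this
  exact this

/-! ### Appended (leafhand g0, third proposal): the QUANTITATIVE damped lifespan (the Lax–John height of instrument I2) -/

/-- **Quantitative backward lifespan for the damped law** (the height `z*` of the card's instrument I2).  If on `[z₁, z₀]`
`α' = −a·α² − h'·α` with `a ≥ a₀ > 0`, `|h| ≤ H` (`h' =` the derivative of `h`) and `α(z₀) > 0`, then
`z₀ − z₁ < e^{2H} / (a₀ α(z₀))`: John's substitution `q = e^{h}α` obeys `q' = −(a e^{−h}) q²` with coefficient `≥ a₀ e^{−H}` and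
`q(z₀) ≥ e^{−H} α(z₀)`, and `riccati_backward_lifespan` applies.  So a transversal derivative of size `|α|` of a Riemann invariant
cannot be carried by a `C²` solution over a height larger than `e^{2H}/(a₀|α|)` in the blow-up direction. [folklore] -/
theorem dampedRiccati_backward_lifespan {α a h h' : ℝ → ℝ} {z₁ z₀ a₀ H : ℝ} (hz : z₁ ≤ z₀) (ha₀ : 0 < a₀)
    (ha : ∀ z ∈ Icc z₁ z₀, a₀ ≤ a z) (hH : ∀ z ∈ Icc z₁ z₀, |h z| ≤ H) (hh : ∀ z ∈ Icc z₁ z₀, HasDerivAt h (h' z) z)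
    (hα : ∀ z ∈ Icc z₁ z₀, HasDerivAt α (-(a z * α z ^ 2) - h' z * α z) z) (hpos : 0 < α z₀) :
    z₀ - z₁ < Real.exp (2 * H) / (a₀ * α z₀) := by
  set q : ℝ → ℝ := fun z => Real.exp (h z) * α z with hq
  have hqd : ∀ z ∈ Icc z₁ z₀, HasDerivAt q (-(a z * Real.exp (-h z) * q z ^ 2)) z := by
    intro z hzI
    have he : HasDerivAt (fun y => Real.exp (h y)) (Real.exp (h z) * h' z) z := (hh z hzI).exp
    refine (he.mul (hα z hzI)).congr_deriv ?_
    have hexp : Real.exp (-h z) * Real.exp (h z) = 1 := by rw [← Real.exp_add]; simp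
    simp only [hq]
    have : a z * Real.exp (-h z) * (Real.exp (h z) * α z) ^ 2 =
        a z * α z ^ 2 * Real.exp (h z) * (Real.exp (-h z) * Real.exp (h z)) := by ring
    rw [this, hexp]
    ring
  have hb : ∀ z ∈ Icc z₁ z₀, a₀ * Real.exp (-H) ≤ a z * Real.exp (-h z) := by
    intro z hzI
    have h1 : Real.exp (-H) ≤ Real.exp (-h z) :=
      Real.exp_le_exp.2 (by linarith [hH z hzI, le_abs_self (h z)])
    calc a₀ * Real.exp (-H) ≤ a z * Real.exp (-H) := mul_le_mul_of_nonneg_right (ha z hzI) (Real.exp_pos _).le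
      _ ≤ a z * Real.exp (-h z) := mul_le_mul_of_nonneg_left h1 (ha₀.le.trans (ha z hzI))
  have hb₀ : 0 < a₀ * Real.exp (-H) := mul_pos ha₀ (Real.exp_pos _)
  have hq₀ : 0 < q z₀ := mul_pos (Real.exp_pos _) hpos
  have hlife := riccati_backward_lifespan (b := fun z => a z * Real.exp (-h z)) hz hb₀ hqd hb hq₀
  -- `1/(b₀ q(z₀)) ≤ e^{2H}/(a₀ α(z₀))`
  refine hlife.trans_le ?_
  have hqz₀ : Real.exp (-H) * α z₀ ≤ q z₀ := by
    have h1 : Real.exp (-H) ≤ Real.exp (h z₀) :=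
      Real.exp_le_exp.2 (by linarith [hH z₀ (right_mem_Icc.2 hz), neg_abs_le (h z₀)])
    exact mul_le_mul_of_nonneg_right h1 hpos.le
  have hden : a₀ * Real.exp (-H) * (Real.exp (-H) * α z₀) ≤ a₀ * Real.exp (-H) * q z₀ :=
    mul_le_mul_of_nonneg_left hqz₀ hb₀.le
  have hpos' : 0 < a₀ * Real.exp (-H) * (Real.exp (-H) * α z₀) := by positivity
  rw [inv_eq_one_div, div_le_div_iff₀ (mul_pos hb₀ hq₀) (by positivity)]
  have hEE : Real.exp (2 * H) * (a₀ * Real.exp (-H) * (Real.exp (-H) * α z₀)) = a₀ * α z₀ := by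
    have : Real.exp (2 * H) * Real.exp (-H) * Real.exp (-H) = 1 := by
      rw [← Real.exp_add, ← Real.exp_add, show 2 * H + -H + -H = 0 by ring, Real.exp_zero]
    calc Real.exp (2 * H) * (a₀ * Real.exp (-H) * (Real.exp (-H) * α z₀))
        = (Real.exp (2 * H) * Real.exp (-H) * Real.exp (-H)) * (a₀ * α z₀) := by ring
      _ = a₀ * α z₀ := by rw [this, one_mul]
  calc 1 * (a₀ * α z₀) = Real.exp (2 * H) * (a₀ * Real.exp (-H) * (Real.exp (-H) * α z₀)) := by rw [hEE, one_mul]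
    _ ≤ Real.exp (2 * H) * (a₀ * Real.exp (-H) * q z₀) :=
        mul_le_mul_of_nonneg_left hden (Real.exp_pos _).le

end Summit.NavierStokesRegularity.NavierStokesRegularity.Theorems.PoloidalWindowDoorPoloidalWindowRigidityZShockRiccatiTwoSided

end
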